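import Mathlib
import HarnessLib.Audit
import Summits.PneNP.PneNP.Theorems.PstarGapOne
import Summits.PneNP.PneNP.Theorems.PstarGapLinearised

/-!
# Free centres, and the AND-parity slice of the single-query rung (ROUND-24, items T24.15 / T24.16)

FRONTIER range-avoidance ladder, rung F-N3, ROUND 24 (cell `pnp-ideate`, planner seat p3; restricted-model proof complexity —
nothing here bears on `P` versus `NP`).

Two statements with paper proofs in the planner memo (ROUND-24-PRESEED §13 R10(j),(k)), filed as targets for the provers.
Vocabulary: for an output set `J` of a pure `P⋆` instance (`out_j = x_u + x_v + a_p·a_q`), the XOR graph `H[J]` has the XOR-type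
variables as vertices and output `j` as the edge between its two XOR slots; a CENTRE of `J` is an AND-type variable lying in the
AND pair of at least two outputs of `J`; `J₀ / J₁ /` chords are the outputs with `2 / 1 / 0` centres among their AND slots.  In a
solution `z` of `J` an output of `J₁` whose centre is inactive (`z = false`) and every output of `J₀` is RIGID (its XOR side is
determined), the others are free.

* `CentreFree` (T24.15; paper-proved): on pure, typed, boundary-expanding instances with simple overlaps, for every target `y`, every
  `J` with `|J| ≤ r` and every centre `d` of `J`, BOTH values of `d` occur among the solutions of `J` on `y` (no dead and no forced
  centre).  Proof sketch: strong induction over sub-families `K` of the non-chord outputs, on the claim "some consistent rigidity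
  pattern has the prescribed value at `d`": an XOR vertex of degree one in `H[K]` never constrains (drop its edge); otherwise `H[K]` is
  tip-free, its boundary consists of `J₁`-leaves and of centres used once in `K`, and `(3/2)`-expansion of the sub-family `K` gives
  `≥ 1.5·k₀ + 0.5·k₁ > 0` single-use centres; a single-use centre of a `J₁` output is activated after solving `K` minus that output
  (the output becomes free and the centre touches nothing else), and otherwise `≥ 0.5(k₀+k₁)` outputs of `J₀ ∩ K` have BOTH centres
  single-use, and such an output is solved last by choosing its two centres in `{(1,1),(1,0),(0,1),(0,0)}` to produce the product its
  XOR side demands; a reduction avoiding `d` always exists (a non-empty tip-free core has `≥ 3` outputs), so the value at `d` is kept.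
  Uses `Typed` (XOR and AND slots carry disjoint variables) and expansion of sub-families only — not `MaxDegree`.
* `GapOneAnd` (T24.16; paper-proved from `CentreFree`): under the same hypotheses, ONE parity constraint supported on AND-type
  variables never makes a non-empty `J` minimally infeasible — the `|W| ≤ 1`, AND-typed slice of `PstarGapOne.PstarGapOne` holds with
  `K = 0` (`gapOne_andSlice_of_gapOneAnd`).  Sketch for a minimal infeasible `J ≠ ∅`: no output has a `J`-private XOR variable; every
  chord carries a constrained variable and has AND-bit `1` in every solution of `J` (else its private pair re-tunes the parity); the
  boundary of the non-chord family forces `≥ 1.5|J₀| + 0.5|J₁|` tips of `H[J₀ ∪ J₁]`, hence a tip on a `J₁` output `f`; if `f` is free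
  in some solution, flipping the tip and repairing `f` by its leaf and the chords at the tip by their pairs reaches the forbidden
  parity; so the centre of `f` is dead — contradicting `CentreFree`.
What remains of T24.12 after T24.16: parities touching XOR variables (memo R10(k): they reduce to "reader" outputs feeding products of
centre pairs into the parity), then `|W| ≥ 2` for the crux `PstarGapLemmaSO`.
-/

set_option linter.dupNamespace false

open Finset Literature.Computability.Complexity
open Summit.PneNP.PneNP.Theorems.PstarTyped (Typed)
open Summit.PneNP.PneNP.Theorems.PstarSALevel (BoundaryExpanding SimpleOverlap)
open Summit.PneNP.PneNP.Theorems.PstarGapLemma (MinInfeasible)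
open Summit.PneNP.PneNP.Theorems.PstarGapLinearised (andPair)

namespace Summit.PneNP.PneNP.Theorems.PstarNoDeadCentre

variable {n m : ℕ}

/-- `d` is a CENTRE of the output set `J`: an AND-slot variable of two distinct outputs of `J`. -/
def IsCentre (I : LocalMap 4 n m) (J : Finset (Fin m)) (d : Fin n) : Prop :=
  ∃ j ∈ J, ∃ j' ∈ J, j ≠ j' ∧ d ∈ andPair I j ∧ d ∈ andPair I j'

/-- `v` is an AND-TYPE variable: it occurs in no XOR slot (positions `0, 1`) of any output. -/
def IsAndVar (I : LocalMap 4 n m) (v : Fin n) : Prop :=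
  ∀ (j : Fin m) (s : Fin 4), s.val < 2 → I.vars j s ≠ v

/-- **T24.15 — free centres (paper-proved, memo §13 R10(j),(k)).**  Every centre of a small output set takes both values among the
solutions: no dead and no forced centre.  FRONTIER. -/
@[conjecture] def CentreFree : Prop :=
  ∀ (n m r : ℕ) (I : LocalMap 4 n m), I.IsPure xorAndPred → Typed I → BoundaryExpanding r I → SimpleOverlap I →
    ∀ (y : Fin m → Bool) (J : Finset (Fin m)), J.card ≤ r → ∀ d : Fin n, IsCentre I J d →
      ∀ b : Bool, ∃ z : Fin n → Bool, (∀ j ∈ J, I.eval z j = y j) ∧ z d = b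

/-- **T24.16 — the AND-parity slice of the single-query rung (paper-proved from `CentreFree`, memo §13 R10(j)).**  One parity
constraint on AND-type variables never makes a non-empty output set minimally infeasible.  FRONTIER. -/
@[conjecture] def GapOneAnd : Prop :=
  ∀ (n m r : ℕ) (I : LocalMap 4 n m), I.IsPure xorAndPred → Typed I → BoundaryExpanding r I → SimpleOverlap I →
    ∀ (y : Fin m → Bool) (W : Finset (Finset (Fin n) × Bool)) (J : Finset (Fin m)),
      (∀ cb ∈ W, ∀ v ∈ cb.1, IsAndVar I v) → W.card ≤ 1 → J.card ≤ r → MinInfeasible I y W J → J = ∅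

/-- `GapOneAnd` gives the `|W| ≤ 1`, AND-typed slice of `PstarGapOne.PstarGapOne` with every constant `K` (in particular `K = 0`),
uniformly in the degree bound (which it does not need). -/
theorem gapOne_andSlice_of_gapOneAnd (h : GapOneAnd) (K : ℕ) :
    ∀ (n m r : ℕ) (I : LocalMap 4 n m), I.IsPure xorAndPred → Typed I → BoundaryExpanding r I → SimpleOverlap I →
      ∀ (y : Fin m → Bool) (W : Finset (Finset (Fin n) × Bool)) (J : Finset (Fin m)),
        (∀ cb ∈ W, ∀ v ∈ cb.1, IsAndVar I v) → W.card ≤ 1 → J.card ≤ r → MinInfeasible I y W J → J.card ≤ K := by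
  intro n m r I hI hT hB hS y W J hW hW1 hJ hmin
  have hJ0 : J = ∅ := h n m r I hI hT hB hS y W J hW hW1 hJ hmin
  simp [hJ0]

/-- A centre in the sense of `IsCentre` lies in at least two AND pairs of `J`. -/
theorem two_le_card_filter_of_isCentre {I : LocalMap 4 n m} {J : Finset (Fin m)} {d : Fin n} (h : IsCentre I J d) :
    2 ≤ (J.filter fun j => d ∈ andPair I j).card := by
  obtain ⟨j, hj, j', hj', hne, hd, hd'⟩ := h
  have hsub : ({j, j'} : Finset (Fin m)) ⊆ J.filter fun j => d ∈ andPair I j := by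
    intro i hi
    simp only [mem_insert, mem_singleton] at hi
    rcases hi with rfl | rfl
    · exact mem_filter.mpr ⟨hj, hd⟩
    · exact mem_filter.mpr ⟨hj', hd'⟩
  calc 2 = ({j, j'} : Finset (Fin m)).card := by rw [card_pair hne]
    _ ≤ _ := card_le_card hsub

end Summit.PneNP.PneNP.Theorems.PstarNoDeadCentre
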